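import Mathlib
import Summits.Ventures.PercRepro2.Defs
import Summits.Ventures.PercRepro2.Independence
import Summits.Ventures.PercRepro2.Harris
import Summits.Ventures.PercRepro2.ZCTwoEdge

/-!
# The leaf reductions of (ZC): a pendant mark `o` or `a₃` reduces (ZC) to the smaller graph
(blind cell PercRepro2, mine-a g23; MINE-A.md §70.4)

(ZC) is `P(D) · Cov(U, eL) ≥ P(B) · Cov(U, e¬L)` with `e = {a₃ ∈ C₁}`, `L = {o ∈ C₁}`,
`U = {C₁ ∈ 𝒰}`, `B = [a₁ | a₃o]`, `D = [a₁ | a₃ | o]` (MINE-A.md §66).  Let the mark `o` be a LEAF,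
joined to the rest only by the edge `f = zo` of weight `w`; write `G⁻ = G − o` (the configuration
with `f` closed).  With `e⁻ = {a₁ ↔ a₃}`, `L_z = {a₁ ↔ z}`, `γ_z = {a₃ ↔ z}` in `G⁻` and the two
cluster events `X₀ = {C⁻(a₁) ∈ 𝒰}`, `X_z = {C⁻(a₁) ∈ 𝒰_z}` (`𝒰_z = {S ∣ (z ∈ S ∧ S ∪ {o} ∈ 𝒰) ∨
(z ∉ S ∧ S ∈ 𝒰)}`, an up-set; `X₀ ⊆ X_z`):
`e = e⁻`, `L = {f open} ∩ L_z`, `γ = {f open} ∩ γ_z`, `U = ({f open} ∩ X_z) ∪ ({f closed} ∩ X₀)`, and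
  **(L_o)**  `(ZC)_G(𝒰) ≥ w · (ZC)_{G⁻}(a₁, a₃, z; 𝒰_z)`,
with the explicit slack `w(1−w)·[P(T₃)(x₁ − ū T₁) + P(B_z)((x₁ + x₂) − (y₁ + y₂)) + (P(X_z) − P(X₀))·(P(D_z)T₁ − P(B_z)T₂)]`
(`T₁ = P(e⁻L_z)`, `T₂ = P(e⁻¬L_z)`, `T₃ = P(¬e⁻L_z)`, `x_i, y_i` the masses of `X_z`, `X₀` on the
cells, `ū = P(U)`): the three brackets are Harris (`x₁ ≥ P(X_z)T₁`), monotonicity (`X₀ ⊆ X_z`) and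
lemma (P1) on `G⁻` (`P(D_z)T₁ ≥ P(B_z)T₂`).  Likewise for a pendant `a₃` at `z'`
(`f = z'a₃`): `e = {f open} ∩ e_{z'}`, `L = L⁻`, `γ = {f open} ∩ γ_{z'}`, and
  **(L₃)**  `(ZC)_G(𝒰) ≥ w² · (ZC)_{G⁻}(a₁, z', o; 𝒰_{z'})`,
slack `w(1−w)·[P(¬L)(x₁ − ū T₁) + w(P(X_{z'}) − P(X₀))(P(D_{z'})T₁ − P(B_{z'})T₂)]`.  Both are
one-edge pinnings (`prob_eq_pin`) plus a polynomial identity; the (P1) input is the cell's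
`partitionThree_lattice` on the graph.  Consequence: the class of (ZC)-graphs is closed under
attaching the marks `o`, `a₃` as leaves.  One seat; identities twinned in exact rationals
(data/mine-a/g23/codes/twin_pendant.py, 300 cells per reduction, 0 failures).
-/

namespace Summit.Ventures.PercRepro2

section OnePin

variable {E : Type*} [Fintype E] [DecidableEq E] {R : Type*} [CommRing R]

/-- **One-edge pinning, shift form**: `P(Z) = p f · P(ω[f ↦ open] ∈ Z) + (1 − p f) · P(ω[f ↦ closed] ∈ Z)`. -/
lemma prob_pin_shift (p : E → R) (f : E) (Z : Set (Config E)) :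
    prob p Z = p f * prob p {ω | Function.update ω f true ∈ Z}
      + (1 - p f) * prob p {ω | Function.update ω f false ∈ Z} := by
  rw [prob_eq_pin p Z f, prob_update_one_eq_shift, prob_update_zero_eq_shift]

end OnePin

section LeafO

variable {E : Type*} [Fintype E] [DecidableEq E] {R : Type*} [CommRing R] [LinearOrder R]
  [IsStrictOrderedRing R]

/-- The algebraic core of (L_o): the (ZC) expression of `G` minus `w` times the (ZC) expression of
`G⁻` equals `w(1−w)` times a sum of three nonnegative products. -/
lemma zc_leaf_o_alg (w T₁ T₂ T₃ Bz Dz x₁ x₂ y₁ y₂ Xt X₀ : R) (hw : 0 ≤ w) (hw' : w ≤ 1)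
    (hT1 : 0 ≤ T₁) (hT3 : 0 ≤ T₃) (hBz : 0 ≤ Bz) (hHar : Xt * T₁ ≤ x₁) (hX : X₀ ≤ Xt)
    (hmono : y₁ + y₂ ≤ x₁ + x₂) (hP1 : Bz * T₂ ≤ Dz * T₁) :
    (w * Dz + (1 - w) * (T₃ + Bz + Dz)) * (w * x₁ - (w * Xt + (1 - w) * X₀) * (w * T₁))
      - w * Bz * (w * x₂ + (1 - w) * (y₁ + y₂)
          - (w * Xt + (1 - w) * X₀) * (w * T₂ + (1 - w) * (T₁ + T₂)))
      ≥ w * (Dz * (x₁ - Xt * T₁) - Bz * (x₂ - Xt * T₂)) := by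
  have h1w : 0 ≤ 1 - w := sub_nonneg.2 hw'
  have hΔ : 0 ≤ Xt - X₀ := sub_nonneg.2 hX
  have hc : 0 ≤ x₁ - (w * Xt + (1 - w) * X₀) * T₁ := by
    have : (w * Xt + (1 - w) * X₀) * T₁ ≤ Xt * T₁ := by
      have := mul_nonneg (mul_nonneg h1w hΔ) hT1
      nlinarith
    linarith
  have hnn : 0 ≤ w * (1 - w) * (T₃ * (x₁ - (w * Xt + (1 - w) * X₀) * T₁)
      + Bz * ((x₁ + x₂) - (y₁ + y₂)) + (Xt - X₀) * (Dz * T₁ - Bz * T₂)) :=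
    mul_nonneg (mul_nonneg hw h1w) (add_nonneg (add_nonneg (mul_nonneg hT3 hc)
      (mul_nonneg hBz (sub_nonneg.2 hmono))) (mul_nonneg hΔ (sub_nonneg.2 hP1)))
  have key : (w * Dz + (1 - w) * (T₃ + Bz + Dz)) * (w * x₁ - (w * Xt + (1 - w) * X₀) * (w * T₁))
      - w * Bz * (w * x₂ + (1 - w) * (y₁ + y₂)
          - (w * Xt + (1 - w) * X₀) * (w * T₂ + (1 - w) * (T₁ + T₂)))
      - w * (Dz * (x₁ - Xt * T₁) - Bz * (x₂ - Xt * T₂))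
      = w * (1 - w) * (T₃ * (x₁ - (w * Xt + (1 - w) * X₀) * T₁)
      + Bz * ((x₁ + x₂) - (y₁ + y₂)) + (Xt - X₀) * (Dz * T₁ - Bz * T₂)) := by ring
  linarith [key, hnn]

/-- **(L_o), abstract form.**  `f` is the leaf edge; `e⁻`, `L_z`, `γ_z`, `X₀`, `X_z` ignore `f`;
`e⁻`, `L_z`, `X_z` increasing; `X₀ ⊆ X_z`; (P1) on `G⁻`: `P(B_z) P(e⁻¬L_z) ≤ P(D_z) P(e⁻L_z)`.  Then
the (ZC) expression of `G` is at least `p f` times the (ZC) expression of `G⁻` for the marks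
`(a₁, a₃, z)` and the up-set event `X_z`. -/
theorem zc_leaf_o {p : E → R} (hp : IsProbVec p) (f : E) {e' Lz γz X₀ Xz : Set (Config E)}
    (he' : ∀ (ω : Config E) (b : Bool), Function.update ω f b ∈ e' ↔ ω ∈ e')
    (hLz : ∀ (ω : Config E) (b : Bool), Function.update ω f b ∈ Lz ↔ ω ∈ Lz)
    (hγz : ∀ (ω : Config E) (b : Bool), Function.update ω f b ∈ γz ↔ ω ∈ γz)
    (hX₀ : ∀ (ω : Config E) (b : Bool), Function.update ω f b ∈ X₀ ↔ ω ∈ X₀)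
    (hXz : ∀ (ω : Config E) (b : Bool), Function.update ω f b ∈ Xz ↔ ω ∈ Xz)
    (he'up : IsUpperSet e') (hLzup : IsUpperSet Lz) (hXzup : IsUpperSet Xz) (hX : X₀ ⊆ Xz)
    (hP1 : prob p (e'ᶜ ∩ Lzᶜ ∩ γz) * prob p (e' ∩ Lzᶜ)
      ≤ prob p (e'ᶜ ∩ Lzᶜ ∩ γzᶜ) * prob p (e' ∩ Lz)) :
    let e := e'
    let L := openEdge f ∩ Lz
    let U := (openEdge f ∩ Xz) ∪ (closedEdge f ∩ X₀)
    let γ := openEdge f ∩ γz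
    prob p (eᶜ ∩ Lᶜ ∩ γᶜ) * (prob p (U ∩ (e ∩ L)) - prob p U * prob p (e ∩ L))
      - prob p (eᶜ ∩ Lᶜ ∩ γ) * (prob p (U ∩ (e ∩ Lᶜ)) - prob p U * prob p (e ∩ Lᶜ))
      ≥ p f * (prob p (e'ᶜ ∩ Lzᶜ ∩ γzᶜ) * (prob p (Xz ∩ (e' ∩ Lz)) - prob p Xz * prob p (e' ∩ Lz))
          - prob p (e'ᶜ ∩ Lzᶜ ∩ γz) * (prob p (Xz ∩ (e' ∩ Lzᶜ)) - prob p Xz * prob p (e' ∩ Lzᶜ))) := by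
  intro e L U γ
  set w := p f with hw
  set T₁ := prob p (e' ∩ Lz) with hT₁
  set T₂ := prob p (e' ∩ Lzᶜ) with hT₂
  set T₃ := prob p (e'ᶜ ∩ Lz) with hT₃
  set Bz := prob p (e'ᶜ ∩ Lzᶜ ∩ γz) with hBz
  set Dz := prob p (e'ᶜ ∩ Lzᶜ ∩ γzᶜ) with hDz
  set x₁ := prob p (Xz ∩ (e' ∩ Lz)) with hx₁
  set x₂ := prob p (Xz ∩ (e' ∩ Lzᶜ)) with hx₂
  set y₁ := prob p (X₀ ∩ (e' ∩ Lz)) with hy₁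
  set y₂ := prob p (X₀ ∩ (e' ∩ Lzᶜ)) with hy₂
  set Xt := prob p Xz with hXt
  set X₀t := prob p X₀ with hX₀t
  -- the totals
  have hN : prob p e'ᶜ = T₃ + Bz + Dz := by
    rw [← prob_inter_add_prob_inter_compl p e'ᶜ Lz,
      ← prob_inter_add_prob_inter_compl p (e'ᶜ ∩ Lzᶜ) γz, ← add_assoc]
  have hPe : prob p e' = T₁ + T₂ := (prob_inter_add_prob_inter_compl p e' Lz).symm
  have hX₀e : prob p (X₀ ∩ e') = y₁ + y₂ := by
    rw [← prob_inter_add_prob_inter_compl p (X₀ ∩ e') Lz, Set.inter_assoc, Set.inter_assoc]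
  -- the pinned probabilities
  have PeL : prob p (e ∩ L) = w * T₁ := by
    rw [prob_pin_shift p f]
    have c1 : {ω | Function.update ω f true ∈ (e ∩ L)} = e' ∩ Lz := by
      ext ω; simp [e, L, he', hLz]
    have c0 : {ω | Function.update ω f false ∈ (e ∩ L)} = ∅ := by
      ext ω; simp [e, L]
    rw [c1, c0, prob_empty]; ring
  have PUeL : prob p (U ∩ (e ∩ L)) = w * x₁ := by
    rw [prob_pin_shift p f]
    have c1 : {ω | Function.update ω f true ∈ (U ∩ (e ∩ L))} = Xz ∩ (e' ∩ Lz) := by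
      ext ω; simp [e, L, U, he', hLz, hXz]; tauto
    have c0 : {ω | Function.update ω f false ∈ (U ∩ (e ∩ L))} = ∅ := by
      ext ω; simp [e, L, U]
    rw [c1, c0, prob_empty]; ring
  have PenL : prob p (e ∩ Lᶜ) = w * T₂ + (1 - w) * (T₁ + T₂) := by
    rw [prob_pin_shift p f]
    have c1 : {ω | Function.update ω f true ∈ (e ∩ Lᶜ)} = e' ∩ Lzᶜ := by
      ext ω; simp [e, L, he', hLz]
    have c0 : {ω | Function.update ω f false ∈ (e ∩ Lᶜ)} = e' := by
      ext ω; simp [e, L, he']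
    rw [c1, c0, hPe]
  have PUenL : prob p (U ∩ (e ∩ Lᶜ)) = w * x₂ + (1 - w) * (y₁ + y₂) := by
    rw [prob_pin_shift p f]
    have c1 : {ω | Function.update ω f true ∈ (U ∩ (e ∩ Lᶜ))} = Xz ∩ (e' ∩ Lzᶜ) := by
      ext ω; simp [e, L, U, he', hLz, hXz]; tauto
    have c0 : {ω | Function.update ω f false ∈ (U ∩ (e ∩ Lᶜ))} = X₀ ∩ e' := by
      ext ω; simp [e, L, U, he', hX₀]
    rw [c1, c0, hX₀e]
  have PU : prob p U = w * Xt + (1 - w) * X₀t := by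
    rw [prob_pin_shift p f]
    have c1 : {ω | Function.update ω f true ∈ U} = Xz := by
      ext ω; simp [U, hXz]
    have c0 : {ω | Function.update ω f false ∈ U} = X₀ := by
      ext ω; simp [U, hX₀]
    rw [c1, c0]
  have PB : prob p (eᶜ ∩ Lᶜ ∩ γ) = w * Bz := by
    rw [prob_pin_shift p f]
    have c1 : {ω | Function.update ω f true ∈ (eᶜ ∩ Lᶜ ∩ γ)} = e'ᶜ ∩ Lzᶜ ∩ γz := by
      ext ω; simp [e, L, γ, he', hLz, hγz]
    have c0 : {ω | Function.update ω f false ∈ (eᶜ ∩ Lᶜ ∩ γ)} = ∅ := by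
      ext ω; simp [e, L, γ]
    rw [c1, c0, prob_empty]; ring
  have PD : prob p (eᶜ ∩ Lᶜ ∩ γᶜ) = w * Dz + (1 - w) * (T₃ + Bz + Dz) := by
    rw [prob_pin_shift p f]
    have c1 : {ω | Function.update ω f true ∈ (eᶜ ∩ Lᶜ ∩ γᶜ)} = e'ᶜ ∩ Lzᶜ ∩ γzᶜ := by
      ext ω; simp [e, L, γ, he', hLz, hγz]
    have c0 : {ω | Function.update ω f false ∈ (eᶜ ∩ Lᶜ ∩ γᶜ)} = e'ᶜ := by
      ext ω; simp [e, L, γ, he']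
    rw [c1, c0, hN]
  -- the probabilistic inputs
  have hHar : Xt * T₁ ≤ x₁ := by
    have := prob_mul_prob_le_prob_inter hp hXzup (he'up.inter hLzup)
    exact this
  have hXle : X₀t ≤ Xt := prob_mono hp hX
  have hmono : y₁ + y₂ ≤ x₁ + x₂ := by
    rw [← hX₀e]
    have : prob p (Xz ∩ e') = x₁ + x₂ := by
      rw [← prob_inter_add_prob_inter_compl p (Xz ∩ e') Lz, Set.inter_assoc, Set.inter_assoc]
    rw [← this]
    exact prob_mono hp (Set.inter_subset_inter_left _ hX)
  have hT1 : 0 ≤ T₁ := prob_nonneg hp _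
  have hT3 : 0 ≤ T₃ := prob_nonneg hp _
  have hBz0 : 0 ≤ Bz := prob_nonneg hp _
  rw [PeL, PUeL, PenL, PUenL, PU, PB, PD]
  exact zc_leaf_o_alg w T₁ T₂ T₃ Bz Dz x₁ x₂ y₁ y₂ Xt X₀t (hp.nonneg f) (hp.le_one f) hT1 hT3
    hBz0 hHar hXle hmono hP1

end LeafO

section LeafA3

variable {E : Type*} [Fintype E] [DecidableEq E] {R : Type*} [CommRing R] [LinearOrder R]
  [IsStrictOrderedRing R]

/-- The algebraic core of (L₃). -/
lemma zc_leaf_a3_alg (w T₁ T₂ Nl Bz Dz x₁ x₂ Xt X₀ : R) (hw : 0 ≤ w) (hw' : w ≤ 1)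
    (hT1 : 0 ≤ T₁) (hNl : 0 ≤ Nl) (hHar : Xt * T₁ ≤ x₁) (hX : X₀ ≤ Xt)
    (hP1 : Bz * T₂ ≤ Dz * T₁) :
    (w * Dz + (1 - w) * Nl) * (w * x₁ - (w * Xt + (1 - w) * X₀) * (w * T₁))
      - w * Bz * (w * x₂ - (w * Xt + (1 - w) * X₀) * (w * T₂))
      ≥ w * w * (Dz * (x₁ - Xt * T₁) - Bz * (x₂ - Xt * T₂)) := by
  have h1w : 0 ≤ 1 - w := sub_nonneg.2 hw'
  have hΔ : 0 ≤ Xt - X₀ := sub_nonneg.2 hX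
  have hc : 0 ≤ x₁ - (w * Xt + (1 - w) * X₀) * T₁ := by
    have : (w * Xt + (1 - w) * X₀) * T₁ ≤ Xt * T₁ := by
      have := mul_nonneg (mul_nonneg h1w hΔ) hT1
      nlinarith
    linarith
  have hnn : 0 ≤ w * (1 - w) * (Nl * (x₁ - (w * Xt + (1 - w) * X₀) * T₁)
      + w * (Xt - X₀) * (Dz * T₁ - Bz * T₂)) :=
    mul_nonneg (mul_nonneg hw h1w) (add_nonneg (mul_nonneg hNl hc)
      (mul_nonneg (mul_nonneg hw hΔ) (sub_nonneg.2 hP1)))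
  have key : (w * Dz + (1 - w) * Nl) * (w * x₁ - (w * Xt + (1 - w) * X₀) * (w * T₁))
      - w * Bz * (w * x₂ - (w * Xt + (1 - w) * X₀) * (w * T₂))
      - w * w * (Dz * (x₁ - Xt * T₁) - Bz * (x₂ - Xt * T₂))
      = w * (1 - w) * (Nl * (x₁ - (w * Xt + (1 - w) * X₀) * T₁)
      + w * (Xt - X₀) * (Dz * T₁ - Bz * T₂)) := by ring
  linarith [key, hnn]

/-- **(L₃), abstract form.**  `f` is the leaf edge at `a₃` (to `z'`); `e_{z'} = {a₁ ↔ z'}`,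
`L⁻ = {a₁ ↔ o}`, `γ_{z'} = {z' ↔ o}`, `X₀`, `X_{z'}` ignore `f`; `e_{z'}`, `L⁻`, `X_{z'}` increasing;
`X₀ ⊆ X_{z'}`; (P1) on `G⁻`: `P(B_{z'}) P(e_{z'}¬L⁻) ≤ P(D_{z'}) P(e_{z'}L⁻)`.  Then the (ZC)
expression of `G` is at least `(p f)²` times the (ZC) expression of `G⁻` for the marks `(a₁, z', o)`
and the up-set event `X_{z'}`. -/
theorem zc_leaf_a3 {p : E → R} (hp : IsProbVec p) (f : E) {ez L' γz X₀ Xz : Set (Config E)}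
    (hez : ∀ (ω : Config E) (b : Bool), Function.update ω f b ∈ ez ↔ ω ∈ ez)
    (hL' : ∀ (ω : Config E) (b : Bool), Function.update ω f b ∈ L' ↔ ω ∈ L')
    (hγz : ∀ (ω : Config E) (b : Bool), Function.update ω f b ∈ γz ↔ ω ∈ γz)
    (hX₀ : ∀ (ω : Config E) (b : Bool), Function.update ω f b ∈ X₀ ↔ ω ∈ X₀)
    (hXz : ∀ (ω : Config E) (b : Bool), Function.update ω f b ∈ Xz ↔ ω ∈ Xz)
    (hezup : IsUpperSet ez) (hL'up : IsUpperSet L') (hXzup : IsUpperSet Xz) (hX : X₀ ⊆ Xz)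
    (hP1 : prob p (ezᶜ ∩ L'ᶜ ∩ γz) * prob p (ez ∩ L'ᶜ)
      ≤ prob p (ezᶜ ∩ L'ᶜ ∩ γzᶜ) * prob p (ez ∩ L')) :
    let e := openEdge f ∩ ez
    let L := L'
    let U := (openEdge f ∩ Xz) ∪ (closedEdge f ∩ X₀)
    let γ := openEdge f ∩ γz
    prob p (eᶜ ∩ Lᶜ ∩ γᶜ) * (prob p (U ∩ (e ∩ L)) - prob p U * prob p (e ∩ L))
      - prob p (eᶜ ∩ Lᶜ ∩ γ) * (prob p (U ∩ (e ∩ Lᶜ)) - prob p U * prob p (e ∩ Lᶜ))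
      ≥ p f * p f * (prob p (ezᶜ ∩ L'ᶜ ∩ γzᶜ) * (prob p (Xz ∩ (ez ∩ L')) - prob p Xz * prob p (ez ∩ L'))
          - prob p (ezᶜ ∩ L'ᶜ ∩ γz) * (prob p (Xz ∩ (ez ∩ L'ᶜ)) - prob p Xz * prob p (ez ∩ L'ᶜ))) := by
  intro e L U γ
  set w := p f with hw
  set T₁ := prob p (ez ∩ L') with hT₁
  set T₂ := prob p (ez ∩ L'ᶜ) with hT₂
  set Nl := prob p L'ᶜ with hNl
  set Bz := prob p (ezᶜ ∩ L'ᶜ ∩ γz) with hBz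
  set Dz := prob p (ezᶜ ∩ L'ᶜ ∩ γzᶜ) with hDz
  set x₁ := prob p (Xz ∩ (ez ∩ L')) with hx₁
  set x₂ := prob p (Xz ∩ (ez ∩ L'ᶜ)) with hx₂
  set Xt := prob p Xz with hXt
  set X₀t := prob p X₀ with hX₀t
  have PeL : prob p (e ∩ L) = w * T₁ := by
    rw [prob_pin_shift p f]
    have c1 : {ω | Function.update ω f true ∈ (e ∩ L)} = ez ∩ L' := by
      ext ω; simp [e, L, hez, hL']
    have c0 : {ω | Function.update ω f false ∈ (e ∩ L)} = ∅ := by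
      ext ω; simp [e, L]
    rw [c1, c0, prob_empty]; ring
  have PUeL : prob p (U ∩ (e ∩ L)) = w * x₁ := by
    rw [prob_pin_shift p f]
    have c1 : {ω | Function.update ω f true ∈ (U ∩ (e ∩ L))} = Xz ∩ (ez ∩ L') := by
      ext ω; simp [e, L, U, hez, hL', hXz]; tauto
    have c0 : {ω | Function.update ω f false ∈ (U ∩ (e ∩ L))} = ∅ := by
      ext ω; simp [e, L, U]
    rw [c1, c0, prob_empty]; ring
  have PenL : prob p (e ∩ Lᶜ) = w * T₂ := by
    rw [prob_pin_shift p f]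
    have c1 : {ω | Function.update ω f true ∈ (e ∩ Lᶜ)} = ez ∩ L'ᶜ := by
      ext ω; simp [e, L, hez, hL']
    have c0 : {ω | Function.update ω f false ∈ (e ∩ Lᶜ)} = ∅ := by
      ext ω; simp [e, L]
    rw [c1, c0, prob_empty]; ring
  have PUenL : prob p (U ∩ (e ∩ Lᶜ)) = w * x₂ := by
    rw [prob_pin_shift p f]
    have c1 : {ω | Function.update ω f true ∈ (U ∩ (e ∩ Lᶜ))} = Xz ∩ (ez ∩ L'ᶜ) := by
      ext ω; simp [e, L, U, hez, hL', hXz]; tauto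
    have c0 : {ω | Function.update ω f false ∈ (U ∩ (e ∩ Lᶜ))} = ∅ := by
      ext ω; simp [e, L, U]
    rw [c1, c0, prob_empty]; ring
  have PU : prob p U = w * Xt + (1 - w) * X₀t := by
    rw [prob_pin_shift p f]
    have c1 : {ω | Function.update ω f true ∈ U} = Xz := by
      ext ω; simp [U, hXz]
    have c0 : {ω | Function.update ω f false ∈ U} = X₀ := by
      ext ω; simp [U, hX₀]
    rw [c1, c0]
  have PB : prob p (eᶜ ∩ Lᶜ ∩ γ) = w * Bz := by
    rw [prob_pin_shift p f]
    have c1 : {ω | Function.update ω f true ∈ (eᶜ ∩ Lᶜ ∩ γ)} = ezᶜ ∩ L'ᶜ ∩ γz := by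
      ext ω; simp [e, L, γ, hez, hL', hγz]
    have c0 : {ω | Function.update ω f false ∈ (eᶜ ∩ Lᶜ ∩ γ)} = ∅ := by
      ext ω; simp [e, L, γ]
    rw [c1, c0, prob_empty]; ring
  have PD : prob p (eᶜ ∩ Lᶜ ∩ γᶜ) = w * Dz + (1 - w) * Nl := by
    rw [prob_pin_shift p f]
    have c1 : {ω | Function.update ω f true ∈ (eᶜ ∩ Lᶜ ∩ γᶜ)} = ezᶜ ∩ L'ᶜ ∩ γzᶜ := by
      ext ω; simp [e, L, γ, hez, hL', hγz]
    have c0 : {ω | Function.update ω f false ∈ (eᶜ ∩ Lᶜ ∩ γᶜ)} = L'ᶜ := by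
      ext ω; simp [e, L, γ, hL']
    rw [c1, c0]
  have hHar : Xt * T₁ ≤ x₁ := prob_mul_prob_le_prob_inter hp hXzup (hezup.inter hL'up)
  have hXle : X₀t ≤ Xt := prob_mono hp hX
  have hT1 : 0 ≤ T₁ := prob_nonneg hp _
  have hNl0 : 0 ≤ Nl := prob_nonneg hp _
  rw [PeL, PUeL, PenL, PUenL, PU, PB, PD]
  exact zc_leaf_a3_alg w T₁ T₂ Nl Bz Dz x₁ x₂ Xt X₀t (hp.nonneg f) (hp.le_one f) hT1 hNl0 hHar
    hXle hP1

end LeafA3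

end Summit.Ventures.PercRepro2
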